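import Literature.AlgebraicGeometry.HodgeTheory.QuaternionicQuarticDoublePlaneGeneric
import HarnessLib

/-!
# One genericity element for the double-plane bridge: `G_e · (a₀ + a₁)`; the deck chart is non-empty there

Layer `Literature/AlgebraicGeometry/HodgeTheory`. One plumbing definition (`doublePlaneGenericityElem e = G_e·(a₀ + a₁) ∈ A = ℂ[a]`)
+ proved API; no named fact. Sequel of `QuaternionicQuarticDoublePlaneModel` ∕ `…Generic` (prover seat
`leafhand-hodge-q8symplecticpowers-4` g4, cell `pub-hsemireg`; route `HodgeConjecture/Q8SymplecticPowers`, crux K1Q,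
stmt-HodgeConjecture-24190; brick **Zb-3** of the S1 programme `stub_regularVeryGeneralQ`).

The complex-point capstone `birationalOver_doublePlane_of_isHypersurfaceCutOutBy` carries four side conditions: `G_e(a) ≠ 0`,
non-empty deck chart, `a₀² ≠ a₁²`, `ψ(u₀, u₁, 1) ≠ 0`. This file reduces them to ONE Zariski-open condition `φ(G_e·(a₀ + a₁)) ≠ 0`:

* `nontrivial_doublePlaneRing`, **`nontrivial_deckRing_of_planeH₂_ne_zero`**, `nontrivial_deckRing_of_field` — the deck chart
  `DeckRing a ≅ (DoublePlaneRing a)_h̄` is NON-EMPTY as soon as `h̄` is a non-zero-divisor of the (non-trivial) double-plane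
  chart ring, i.e. under `a₀² ≠ a₁²`, `ψ(u₀, u₁, 1) ≠ 0` over a field (no point-hunting on the quartic);
* `ψ₂_aφ_ne_zero_of_genericity` — `ψ(u₀, u₁, 1) ≠ 0` at every field point with `φ(G_e) ≠ 0` (the tree's witness `wit₁`
  dehomogenised, as in `eval_zφ_ψ₂_ne_zero` but without injectivity);
* `doublePlaneGenericityElem`, `doublePlaneGenericityElem_ne_zero` (`e ≥ 2`), **`genericity_of_eval_ne_zero`** —
  `φ(G_e·(a₀ + a₁)) ≠ 0 ⇒ φ(G_e) ≠ 0 ∧ a₀² ≠ a₁² ∧ ψ(u₀,u₁,1) ≠ 0`;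
* **`birationalOver_doublePlane_of_genericity`** — at every complex point off the hypersurface `G_e·(a₀ + a₁) = 0`, EVERY `V`
  cut out by the quaternionic quartic form is birational over `ℂ` to the double plane `Spec (DoublePlaneRing a)`.

Honest scope: genericity bookkeeping; nothing here bears on HC; S1 ∕ K1Q NOT proved.

## References

* [Zariski1929] O. Zariski, On the linear connection index of the algebraic surfaces zⁿ = f(x, y), PNAS 15 (1929).
* [Kollar2007] J. Kollár, Lectures on Resolution of Singularities (2007), §3.3.
* [AtiyahMacdonald1969] M. F. Atiyah, I. G. Macdonald, Introduction to Commutative Algebra (1969), Prop. 3.9, Ex. 3.7.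
* [Lang2002] S. Lang, Algebra (3rd ed., 2002), Ch. IV §1.
-/

noncomputable section

open MvPolynomial CategoryTheory AlgebraicGeometry
open Literature.AlgebraicGeometry.Motives

namespace Literature.AlgebraicGeometry.HodgeTheory.Q8Family

/-! ### Non-emptiness of the deck chart from the double plane -/

section Nontrivial

universe v

variable {R : Type v} [CommRing R] [IsDomain R] {e : ℕ} (a : CIdx e → R) (dinv : R)
  (hd : (coefLin a 0 ^ 2 - coefLin a 1 ^ 2) * dinv = 1)
include hd

/-- The double-plane chart ring is non-trivial (it is `AdjoinRoot` of a quadratic over the domain `R[s, y]`).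
[cite: Zariski1929] -/
theorem nontrivial_doublePlaneRing : Nontrivial (DoublePlaneRing a) := by
  have hdeg : (planeF a dinv).degree ≠ 0 := by
    rw [planeF, Polynomial.degree_X_pow_sub_C (by norm_num) _]
    norm_num
  haveI : Nontrivial (AdjoinRoot (planeF a dinv)) :=
    (AdjoinRoot.of.injective_of_degree_ne_zero hdeg).nontrivial
  exact ((doublePlaneRingEquivPlane a dinv hd).trans (planeDoubleRingEquivAdjoinRoot a dinv)).symm.injective.nontrivial

/-- **The deck chart is NON-EMPTY when `h̄` is a non-zero-divisor**: `DeckRing a ≅ (DoublePlaneRing a)_h̄` is non-trivial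
(`R` a domain, `(a₀² − a₁²)dinv = 1`, `H₂ ≠ 0`). [cite: AtiyahMacdonald1969, Prop. 3.9 and Ex. 3.7] -/
theorem nontrivial_deckRing_of_planeH₂_ne_zero (hH : planeH₂ a dinv ≠ 0) : Nontrivial (DeckRing a) := by
  haveI := nontrivial_doublePlaneRing a dinv hd
  have hinj := algebraMap_away_injective_of_mem_nonZeroDivisors a (hBar_mem_nonZeroDivisors a dinv hd hH)
  haveI : Nontrivial (Localization.Away (hBar a)) := hinj.nontrivial
  exact (deckRingEquivAway a).symm.injective.nontrivial

end Nontrivial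

section NontrivialField

universe v

variable {K : Type v} [Field K] {e : ℕ} (a : CIdx e → K)

/-- **Over a field**: `a₀² ≠ a₁²` and `ψ(u₀, u₁, 1) ≠ 0` make the deck chart non-empty. [cite: AtiyahMacdonald1969, Prop. 3.9 and Ex. 3.7] -/
theorem nontrivial_deckRing_of_field (hdet : coefLin a 0 ^ 2 - coefLin a 1 ^ 2 ≠ 0) (hψ : ψ₂ a ≠ 0) :
    Nontrivial (DeckRing a) := by
  have hd : (coefLin a 0 ^ 2 - coefLin a 1 ^ 2) * (coefLin a 0 ^ 2 - coefLin a 1 ^ 2)⁻¹ = 1 := mul_inv_cancel₀ hdet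
  have h01 : coefLin a 0 + coefLin a 1 ≠ 0 := by
    intro h
    apply hdet
    have : coefLin a 0 ^ 2 - coefLin a 1 ^ 2 = (coefLin a 0 - coefLin a 1) * (coefLin a 0 + coefLin a 1) := by ring
    rw [this, h, mul_zero]
  exact nontrivial_deckRing_of_planeH₂_ne_zero a _ hd
    (planeH₂_ne_zero a _ (inv_ne_zero hdet) h01 (planeΨ₂_ne_zero a _ hd hψ))

end NontrivialField

/-! ### One genericity element -/

section Genericity

variable (e : ℕ)

/-- **The double-plane genericity element** `G_e · (a₀ + a₁) ∈ A = ℂ[a]` (plumbing definition).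
[cite: Kollar2007, §3.3] -/
def doublePlaneGenericityElem : ParamRing e := genericityElem e * (aLin e 0 + aLin e 1)

/-- `a₀ + a₁ ≠ 0` in `A`. [cite: Lang2002, Ch. IV §1 (polynomial rings: the variables are algebraically independent)] -/
theorem aLin_add_ne_zero : aLin e 0 + aLin e 1 ≠ 0 := by
  classical
  intro h
  have hne : (Sum.inl (linIdx 1) : CIdx e) ≠ Sum.inl (linIdx 0) := fun h'' =>
    absurd (linIdx_injective (Sum.inl_injective h'')) (by decide)
  have h' := congrArg (MvPolynomial.eval (fun i : CIdx e => if i = Sum.inl (linIdx 0) then (1 : ℂ) else 0)) h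
  simp [aLin, hne] at h'

/-- `G_e · (a₀ + a₁) ≠ 0` (`e ≥ 2`). [cite: Lang2002, Ch. IV §1 (polynomial rings over a domain are domains)] -/
theorem doublePlaneGenericityElem_ne_zero (he : 2 ≤ e) : doublePlaneGenericityElem e ≠ 0 :=
  mul_ne_zero (genericityElem_ne_zero e he) (aLin_add_ne_zero e)

variable {e} {L : Type} [Field L] (φ : ParamRing e →+* L)

/-- `ψ(u₀, u₁, 1) ≠ 0` at every field point with `φ(G_e) ≠ 0` (witness `wit₁` dehomogenised).
[cite: Kollar2007, §3.3] -/
theorem ψ₂_aφ_ne_zero_of_genericity (hG : φ (genericityElem e) ≠ 0) : ψ₂ (aφ φ) ≠ 0 := by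
  have hG' := hG
  simp only [genericityElem, map_mul, mul_ne_zero_iff] at hG'
  obtain ⟨⟨⟨⟨⟨h0, -⟩, -⟩, -⟩, hw⟩, -⟩ := hG'
  intro hz0
  have hz : eval (zφ φ) (ψ₂ (aφ φ)) = 0 := by rw [hz0, map_zero]
  have h := eval_zφ_dehom₂ φ (isHomogeneous_ψOfR fun i => (X i : ParamRing e)) h0
  rw [ψ₂_aφ, ← dehom₂_map] at hz
  rw [hz, mul_zero] at h
  exact hw h.symm

/-- **`φ(G_e·(a₀ + a₁)) ≠ 0` gives all side conditions of the double-plane bridge**: `φ(G_e) ≠ 0`, `a₀² ≠ a₁²`,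
`ψ(u₀, u₁, 1) ≠ 0`. [cite: Kollar2007, §3.3] -/
theorem genericity_of_eval_ne_zero (h : φ (doublePlaneGenericityElem e) ≠ 0) :
    φ (genericityElem e) ≠ 0 ∧ coefLin (aφ φ) 0 ^ 2 - coefLin (aφ φ) 1 ^ 2 ≠ 0 ∧ ψ₂ (aφ φ) ≠ 0 := by
  rw [doublePlaneGenericityElem, map_mul, mul_ne_zero_iff] at h
  obtain ⟨hG, hplus⟩ := h
  refine ⟨hG, ?_, ψ₂_aφ_ne_zero_of_genericity φ hG⟩
  have hG' := hG
  simp only [genericityElem, map_mul, mul_ne_zero_iff] at hG'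
  obtain ⟨⟨⟨-, hminus⟩, -⟩, -⟩ := hG'
  change φ (aLin e 0) ^ 2 - φ (aLin e 1) ^ 2 ≠ 0
  have : φ (aLin e 0) ^ 2 - φ (aLin e 1) ^ 2 = -(φ (aLin e 1 - aLin e 0) * φ (aLin e 0 + aLin e 1)) := by
    rw [map_sub, map_add]; ring
  rw [this, neg_ne_zero]
  exact mul_ne_zero hminus hplus

end Genericity

/-! ### The capstone under one genericity condition -/

section Capstone

variable (e : ℕ)

/-- **Every model of the quaternionic quartic multiple plane is birational to the double plane, off ONE hypersurface of
parameters.** For a complex point `φ` of `A = ℂ[a]` with `φ(G_e·(a₀ + a₁)) ≠ 0` (`e ≥ 2`) and every `V` cut out in `ℙ³_ℂ` by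
the quaternionic quartic form of `(c_a, ψ_a)` (`a = φ ∘ X`): `Spec (DoublePlaneRing a) ~bir V` over `Spec ℂ`.
[cite: Zariski1929] [cite: GortzWedhorn2020, Prop. 4.32 (2)] -/
theorem birationalOver_doublePlane_of_genericity (φ : ParamRing e →+* ℂ) (he : 2 ≤ e)
    (h : φ (doublePlaneGenericityElem e) ≠ 0) {V : SchemeOver ℂ}
    (hV : IsHypersurfaceCutOutBy 3 (quarticForm e (cOf fun i => φ (X i)) (ψOf fun i => φ (X i))) V) :
    Scheme.BirationalOver
      (Spec.map (CommRingCat.ofHom (algebraMap ℂ (DoublePlaneRing (fun i => φ (X i) : CIdx e → ℂ))))) V.hom := by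
  obtain ⟨hG, hdet, hψ⟩ := genericity_of_eval_ne_zero φ h
  haveI : Nontrivial (DeckRing (fun i => φ (X i) : CIdx e → ℂ)) := nontrivial_deckRing_of_field (aφ φ) hdet hψ
  exact birationalOver_doublePlane_of_isHypersurfaceCutOutBy e φ (le_trans (by norm_num) he) hG hdet hψ hV

end Capstone

end Literature.AlgebraicGeometry.HodgeTheory.Q8Family

end
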